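import Summits.QuantumFields.YangMills.Theorems.FemtoCutoffLadderDyadicTelescoping

/-!
# Femto transfer gap — THE TOWER LADDER (rev-9 shape of route `FemtoCutoffLadder`): ONE bounded incommensurable step `L → L₀·2^{I+j}`,
# the nested chain DOWN ONE DYADIC TOWER `L₀·2^{I+j} → … → L₀·2^I` with summable R1 defects, the coarse pair `(L₀·2^I, 1)`, the anchor

Lead seat `ym-line-fcl-p1` (2026-08-28).  Route rev 9 (owner ym-idea-1 g2) states the nested octave step `OctaveStepDecay` (stmt-QuantumFields-24153)
in TOWER form — only along `L' = L₀·2^i` — with the telescoping asymptotic-scaling allowance `D(1/β' − 1/β)` (the lead's repair R1 of the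
matched-two-loop-label defect, three-loop scaling `q(SU(2)) = +0.08324` [cite: AllesFeoPanagopoulos1997, eq. (3.7)]; evidence
`Cruxes/UniformStepScaling/Misstated.md`), and the incommensurable step `SubOctaveBounded` (stmt-QuantumFields-24085) with a merely bounded defect.
This module is the route-independent telescoping for exactly that shape (hypotheses spelled out; the closer file feeds the route decls in):

★ `femtoGapOfRecord_of_towerLadder` — (hO) tower octave step, slack `exp(CΛ²/L'^σ + D(1/β' − 1/β))`, `D ≥ 0`, `L₀ > 0`; (hB) one bounded step
`L' ≤ L < 2L'` above `L₀'`, slack `exp(C_BΛ²)`; (hP) coarse pairs `(L,1)`; (hA) anchor; (hM) deep-window matching ⟹ `FemtoGapOfRecord`.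

THE ARGUMENT.  `M := L₀·2^I` with `I := L₀'` (so `M ≥ L₀'`, and `M·2^j = L₀·2^{I+j}` stays on the tower).  (i) Chain (induction on `j`): every window
point on `M·2^j` obeys `a ≤ exp(−ε₁Λ + Φ(M2^j)Λ² + D(Λ³/2 − 1/β))·b`, `Φ(m) = K₀ + (C⁺/κ)(1 − m^{−σ})`, `κ = 1 − 2^{−σ}`, `K₀ = |C_a| + Σ_{L≤M}|C_L|`
— base: coarse pair `(M,1)` + anchor (`1/β ≤ Λ³/2` makes the budget nonnegative); step: the slack `C·m'^{−σ}` is paid by `Φ(2m') − Φ(m') = C⁺m'^{−σ}`,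
the partner's `−D/β'` cancels the step's `+D/β'`.  (ii) Any `L`: `L < M` coarse pair + anchor; `L ≥ M`: `j := log₂⌊L/M⌋`, one bounded step
`(L, M2^j)`, then (i); leftover budget `D(Λ³/2 − 1/β') ≤ (D/2)Λ²`.  (iii) `L`-th roots.  `C = max(C_B,0) + K₀ + max(C,0)/κ + D/2`, `L₀(lam) = 0`.

HONEST FRAMING: bookkeeping only; neither step nor the fixed-lattice leaf is proved here; R2b1 is a RECORD rung — not infinite volume, not a
mass gap, not Clay.  No definitions, no named facts, no `sorry`.
-/

set_option autoImplicit false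

noncomputable section

namespace Summit.QuantumFields.YangMills.Theorems.FemtoTransferGap.CutoffLadder

open Real
open Summit.QuantumFields.YangMills.Theorems.FemtoTransferGap
open Literature.Analysis.OperatorTheory.YMMatrixModel (luscherEps1)

/-- ★ **THE TOWER LADDER.**  (hO) nested octave step ALONG ONE TOWER `L' = L₀·2^i`, `L = 2L'`, `L₀ > 0`, slack
`exp(CΛ²/L'^σ + D(1/β' − 1/β))`, `D ≥ 0` (= the body of `OctaveStepDecay`, rev 9); (hB) ONE bounded incommensurable step `L' ≤ L < 2L'`, `L' ≥ L₀'`,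
slack `exp(C_BΛ²)` (= `SubOctaveBounded`); (hP) coarse pairs `(L, 1)`; (hA) one-site anchor; (hM) deep-window matching (`lam ≤ 1/2`) ⟹ the rung leaf
`FemtoGapOfRecord` (`C = max(C_B,0) + |C_a| + Σ_{L ≤ M}|C_L| + max(C,0)/(1 − 2^{−σ}) + D/2`, `M = L₀·2^{L₀'}`, `L₀(lam) = 0`).
[cite: LuscherWeiszWolff1991] [cite: AllesFeoPanagopoulos1997, eq. (3.7)] -/
theorem femtoGapOfRecord_of_towerLadder
    (hO : ∃ (C σ D lam0 : ℝ) (L0 : ℕ), 0 < L0 ∧ 0 < σ ∧ 0 < lam0 ∧ 0 ≤ D ∧ ∀ lam : ℝ, 0 < lam → lam ≤ lam0 →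
      ∀ (i : ℕ) (L' : ℕ) [NeZero L'] (L : ℕ) [NeZero L], L' = L0 * 2 ^ i → L = 2 * L' →
        ∀ β β' : ℝ, InFemtoWindow lam β L → InFemtoWindow lam β' L' → luscherLambda β L = luscherLambda β' L' →
          secondValue su2Rep L β ^ L * topValue su2Rep L' β' ^ L' ≤
            Real.exp (C * luscherLambda β L ^ 2 / (L' : ℝ) ^ σ + D * (1 / β' - 1 / β)) *
              (secondValue su2Rep L' β' ^ L' * topValue su2Rep L β ^ L))
    (hB : ∃ (C lam0 : ℝ) (L0 : ℕ), 0 < lam0 ∧ ∀ lam : ℝ, 0 < lam → lam ≤ lam0 →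
      ∀ (L' : ℕ) [NeZero L'] (L : ℕ) [NeZero L], L0 ≤ L' → L' ≤ L → L < 2 * L' →
        ∀ β β' : ℝ, InFemtoWindow lam β L → InFemtoWindow lam β' L' → luscherLambda β L = luscherLambda β' L' →
          secondValue su2Rep L β ^ L * topValue su2Rep L' β' ^ L' ≤
            Real.exp (C * luscherLambda β L ^ 2) * (secondValue su2Rep L' β' ^ L' * topValue su2Rep L β ^ L))
    (hP : ∀ (L : ℕ) [NeZero L], ∃ C lam0 : ℝ, 0 < lam0 ∧ ∀ lam : ℝ, 0 < lam → lam ≤ lam0 →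
      ∀ β β' : ℝ, InFemtoWindow lam β L → InFemtoWindow lam β' 1 → luscherLambda β L = luscherLambda β' 1 →
        secondValue su2Rep L β ^ L * topValue su2Rep 1 β' ^ 1 ≤
          Real.exp (C * luscherLambda β L ^ 2) * (secondValue su2Rep 1 β' ^ 1 * topValue su2Rep L β ^ L))
    (hA : ∃ C lam0 : ℝ, 0 < lam0 ∧ ∀ lam : ℝ, 0 < lam → lam ≤ lam0 → ∀ β : ℝ, InFemtoWindow lam β 1 →
      secondValue su2Rep 1 β ≤ Real.exp (-(zLower C β 1)) * topValue su2Rep 1 β)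
    (hM : ∀ lam : ℝ, 0 < lam → lam ≤ 1 / 2 → ∀ (L : ℕ) [NeZero L] (L' : ℕ) [NeZero L'] (β : ℝ),
      InFemtoWindow lam β L → ∃ β' : ℝ, InFemtoWindow lam β' L' ∧ luscherLambda β' L' = luscherLambda β L) :
    FemtoGapOfRecord := by
  obtain ⟨Co, σ, D, lamO, L0o, hL0o, hσ, hlamO, hD, HO⟩ := hO
  obtain ⟨Cb, lamB, L0b, hlamB, HB⟩ := hB
  obtain ⟨Ca, lamA, hlamA, HA⟩ := hA
  choose Cp lamP hlamP HP using fun n : ℕ => hP (n + 1)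
  -- the chain bottom `M = L₀·2^I` on the tower, above the bounded-step threshold, and the merged constants
  set I : ℕ := L0b with hIdef
  set M : ℕ := L0o * 2 ^ I with hMdef
  have hMpos : 0 < M := by positivity
  have hML0b : L0b ≤ M := by
    calc L0b ≤ 2 ^ L0b := (Nat.lt_two_pow_self).le
      _ = 1 * 2 ^ I := by rw [hIdef, one_mul]
      _ ≤ L0o * 2 ^ I := Nat.mul_le_mul_right _ hL0o
  have hne : (Finset.range M).Nonempty := ⟨0, Finset.mem_range.mpr hMpos⟩
  set Cop : ℝ := max Co 0 with hCop
  have hCop0 : 0 ≤ Cop := le_max_right _ _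
  have hCole : Co ≤ Cop := le_max_left _ _
  set Cbp : ℝ := max Cb 0 with hCbp
  have hCbp0 : 0 ≤ Cbp := le_max_right _ _
  have hCble : Cb ≤ Cbp := le_max_left _ _
  set q : ℝ := (1 / 2 : ℝ) ^ σ with hq_def
  have hq1 : q < 1 := Real.rpow_lt_one (by norm_num) (by norm_num) hσ
  set κ : ℝ := 1 - q with hκ_def
  have hκ : 0 < κ := by rw [hκ_def]; linarith
  have hqκ : q = 1 - κ := by rw [hκ_def]; ring
  set Msum : ℝ := ∑ n ∈ Finset.range M, |Cp n| with hMsum_def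
  set K0 : ℝ := |Ca| + Msum with hK0
  set Ctot : ℝ := Cbp + K0 + Cop / κ + D / 2 with hCtot
  set lamPmin : ℝ := (Finset.range M).inf' hne lamP with hlamPmin_def
  have hlamPmin : 0 < lamPmin := (Finset.lt_inf'_iff hne).mpr fun n _ => hlamP n
  -- potential and running constant along the chain
  let w : ℕ → ℝ := fun m => (((m : ℕ) : ℝ) ^ σ)⁻¹
  let Φ : ℕ → ℝ := fun m => K0 + Cop / κ * (1 - w m)
  have hw0 : ∀ m : ℕ, 0 ≤ w m := fun m => inv_nonneg.mpr (Real.rpow_nonneg (Nat.cast_nonneg m) σ)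
  have hw1 : ∀ m : ℕ, 0 < m → w m ≤ 1 := fun m hm => by
    haveI : NeZero m := ⟨Nat.pos_iff_ne_zero.mp hm⟩
    exact potential_le_one hσ.le m
  have hΦle : ∀ m : ℕ, Φ m ≤ K0 + Cop / κ := fun m => by
    have hck : 0 ≤ Cop / κ := div_nonneg hCop0 hκ.le
    have : Cop / κ * (1 - w m) ≤ Cop / κ := by nlinarith [hw0 m]
    show K0 + Cop / κ * (1 - w m) ≤ K0 + Cop / κ
    linarith
  have hΦge : ∀ m : ℕ, 0 < m → K0 ≤ Φ m := fun m hm => by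
    have : 0 ≤ Cop / κ * (1 - w m) := mul_nonneg (div_nonneg hCop0 hκ.le) (by linarith [hw1 m hm])
    show K0 ≤ K0 + Cop / κ * (1 - w m)
    linarith
  refine ⟨Ctot, min (min lamO lamB) (min lamA (min lamPmin (1 / 2))),
    lt_min (lt_min hlamO hlamB) (lt_min hlamA (lt_min hlamPmin (by norm_num))), ?_⟩
  intro lam hlam hle
  have hleO : lam ≤ lamO := hle.trans ((min_le_left _ _).trans (min_le_left _ _))
  have hleB : lam ≤ lamB := hle.trans ((min_le_left _ _).trans (min_le_right _ _))
  have hleA : lam ≤ lamA := hle.trans ((min_le_right _ _).trans (min_le_left _ _))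
  have hleP : lam ≤ lamPmin := hle.trans ((min_le_right _ _).trans ((min_le_right _ _).trans (min_le_left _ _)))
  have hhalf : lam ≤ 1 / 2 := hle.trans ((min_le_right _ _).trans ((min_le_right _ _).trans (min_le_right _ _)))
  -- coarse pair + anchor on any lattice `n + 1 ≤ M`: exponent `−ε₁Λ + K0·Λ²`
  have base : ∀ n : ℕ, n + 1 ≤ M → ∀ β : ℝ, InFemtoWindow lam β (n + 1) →
      secondValue su2Rep (n + 1) β ^ (n + 1) ≤
        Real.exp (-(luscherEps1 * luscherLambda β (n + 1)) + K0 * luscherLambda β (n + 1) ^ 2) *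
          topValue su2Rep (n + 1) β ^ (n + 1) := by
    intro n hn β hW
    set Λ : ℝ := luscherLambda β (n + 1) with hΛ
    have hb : 0 ≤ topValue su2Rep (n + 1) β ^ (n + 1) := pow_nonneg (topValue_su2Rep_pos (n + 1) β).le _
    have hnr : n ∈ Finset.range M := Finset.mem_range.mpr (by omega)
    have hleP' : lam ≤ lamP n := hleP.trans (Finset.inf'_le lamP hnr)
    obtain ⟨β', hW', hmatch⟩ := hM lam hlam hhalf (n + 1) 1 β hW
    have h1 := HP n lam hlam hleP' β β' hW hW' hmatch.symm
    simp only [pow_one] at h1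
    have h2 := HA lam hlam hleA β' hW'
    have hb' : 0 < topValue su2Rep 1 β' := topValue_su2Rep_pos 1 β'
    have h3 := le_of_pair_of_partner hb' hb h1 h2
    refine h3.trans (exp_mul_le_exp_mul ?_ hb)
    have hz : zLower Ca β' 1 = luscherEps1 * Λ - Ca * Λ ^ 2 := by
      show luscherEps1 * luscherLambda β' 1 - Ca * luscherLambda β' 1 ^ 2 = _
      rw [hmatch]
    rw [hz]
    have hCpM : Cp n ≤ Msum := (le_abs_self _).trans (Finset.single_le_sum (fun m _ => abs_nonneg (Cp m)) hnr)
    have hCa : Ca ≤ |Ca| := le_abs_self _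
    have hsum : (Cp n + Ca) * Λ ^ 2 ≤ K0 * Λ ^ 2 := mul_le_mul_of_nonneg_right (by linarith) (sq_nonneg Λ)
    linarith
  -- ### (i) the nested chain `M·2^j`
  have chain : ∀ j : ℕ, ∀ (m : ℕ) [NeZero m], m = M * 2 ^ j → ∀ β : ℝ, InFemtoWindow lam β m →
      secondValue su2Rep m β ^ m ≤
        Real.exp (-(luscherEps1 * luscherLambda β m) + Φ m * luscherLambda β m ^ 2 +
            D * (luscherLambda β m ^ 3 / 2 - 1 / β)) * topValue su2Rep m β ^ m := by
    intro j
    induction j with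
    | zero =>
      intro m _ hm β hW
      have hmM : m = M := by rw [hm]; ring
      obtain ⟨n, rfl⟩ : ∃ n, m = n + 1 := Nat.exists_eq_succ_of_ne_zero (NeZero.ne m)
      have hb : 0 ≤ topValue su2Rep (n + 1) β ^ (n + 1) := pow_nonneg (topValue_su2Rep_pos (n + 1) β).le _
      have h := base n (by omega) β hW
      refine h.trans (exp_mul_le_exp_mul ?_ hb)
      have hbud : 0 ≤ D * (luscherLambda β (n + 1) ^ 3 / 2 - 1 / β) :=
        mul_nonneg hD (by linarith [inv_le_half_luscherLambda_cube hlam hW])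
      have hK : K0 * luscherLambda β (n + 1) ^ 2 ≤ Φ (n + 1) * luscherLambda β (n + 1) ^ 2 :=
        mul_le_mul_of_nonneg_right (hΦge (n + 1) (Nat.succ_pos n)) (sq_nonneg _)
      linarith
    | succ j ih =>
      intro m _ hm β hW
      set m' : ℕ := M * 2 ^ j with hm'
      have hm'pos : 0 < m' := by positivity
      haveI : NeZero m' := ⟨hm'pos.ne'⟩
      have hmm' : m = 2 * m' := by rw [hm, hm', pow_succ]; ring
      have htower : m' = L0o * 2 ^ (I + j) := by rw [hm', hMdef, pow_add, mul_assoc]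
      set Λ : ℝ := luscherLambda β m with hΛ
      have hb : 0 ≤ topValue su2Rep m β ^ m := pow_nonneg (topValue_su2Rep_pos m β).le _
      obtain ⟨β', hW', hmatch⟩ := hM lam hlam hhalf m m' β hW
      have h1 := HO lam hlam hleO (I + j) m' m htower hmm' β β' hW hW' hmatch.symm
      have h2 := ih m' rfl β' hW'
      have hb' : 0 < topValue su2Rep m' β' ^ m' := pow_pos (topValue_su2Rep_pos m' β') _
      have h3 := le_of_pair_of_partner hb' hb h1 h2
      refine h3.trans (exp_mul_le_exp_mul ?_ hb)
      rw [hmatch]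
      have hslack : Co * Λ ^ 2 / ((m' : ℕ) : ℝ) ^ σ = Co * w m' * Λ ^ 2 := by
        show Co * Λ ^ 2 / ((m' : ℕ) : ℝ) ^ σ = Co * (((m' : ℕ) : ℝ) ^ σ)⁻¹ * Λ ^ 2
        ring
      rw [hslack]
      have hcontr : w m ≤ q * w m' := by
        show (((m : ℕ) : ℝ) ^ σ)⁻¹ ≤ (1 / 2 : ℝ) ^ σ * (((m' : ℕ) : ℝ) ^ σ)⁻¹
        rw [hmm']
        exact potential_half σ hm'pos
      have hbudget := step_budget hCole hCop0 hκ hqκ (hw0 m') hcontr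
      have hΦm : Φ m = K0 + Cop / κ * (1 - w m) := rfl
      have hΦm' : Φ m' = K0 + Cop / κ * (1 - w m') := rfl
      rw [hΦm, hΦm']
      have hsplit : D * (Λ ^ 3 / 2 - 1 / β') = D * (Λ ^ 3 / 2) - D * (1 / β') := by ring
      have hsplit2 : D * (Λ ^ 3 / 2 - 1 / β) = D * (Λ ^ 3 / 2) - D * (1 / β) := by ring
      have hsplit3 : D * (1 / β' - 1 / β) = D * (1 / β') - D * (1 / β) := by ring
      have hprod : (Co * w m' + (K0 + Cop / κ * (1 - w m'))) * Λ ^ 2 ≤ (K0 + Cop / κ * (1 - w m)) * Λ ^ 2 :=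
        mul_le_mul_of_nonneg_right (by linarith) (sq_nonneg Λ)
      have hexp : (Co * w m' + (K0 + Cop / κ * (1 - w m'))) * Λ ^ 2 =
          Co * w m' * Λ ^ 2 + (K0 + Cop / κ * (1 - w m')) * Λ ^ 2 := by ring
      rw [hsplit3, hsplit, hsplit2]
      linarith [hprod, hexp]
  -- ### (ii) any lattice, then (iii) `L`-th roots; `L₀(lam) = 0`
  refine ⟨0, ?_⟩
  intro L _ _ β hW
  have hΛ0 : 0 ≤ luscherLambda β L := hlam.le.trans hW.2.1
  have hΛ1 : luscherLambda β L ≤ 1 := hW.2.2.trans (by linarith)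
  have hβ0 : 0 < β := by linarith [hW.1]
  have hcube : luscherLambda β L ^ 3 ≤ luscherLambda β L ^ 2 := by
    calc luscherLambda β L ^ 3 = luscherLambda β L ^ 2 * luscherLambda β L := by ring
      _ ≤ luscherLambda β L ^ 2 * 1 := mul_le_mul_of_nonneg_left hΛ1 (sq_nonneg _)
      _ = luscherLambda β L ^ 2 := mul_one _
  have hb : 0 ≤ topValue su2Rep L β ^ L := pow_nonneg (topValue_su2Rep_pos L β).le _
  have hck : 0 ≤ Cop / κ := div_nonneg hCop0 hκ.le
  -- the pow-level bound with the total constant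
  have hpow : secondValue su2Rep L β ^ L ≤ Real.exp (-(zLower Ctot β L)) * topValue su2Rep L β ^ L := by
    by_cases hLM : L < M
    · -- small lattice: coarse pair + anchor
      obtain ⟨n, rfl⟩ : ∃ n, L = n + 1 := Nat.exists_eq_succ_of_ne_zero (NeZero.ne L)
      have h := base n (by omega) β hW
      refine h.trans (exp_mul_le_exp_mul ?_ hb)
      show -(luscherEps1 * luscherLambda β (n + 1)) + K0 * luscherLambda β (n + 1) ^ 2 ≤
        -(luscherEps1 * luscherLambda β (n + 1) - Ctot * luscherLambda β (n + 1) ^ 2)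
      have : K0 * luscherLambda β (n + 1) ^ 2 ≤ Ctot * luscherLambda β (n + 1) ^ 2 :=
        mul_le_mul_of_nonneg_right (by rw [hCtot]; linarith) (sq_nonneg _)
      linarith
    · -- large lattice: one bounded step to `M·2^j`, then the chain
      push Not at hLM
      obtain ⟨j, hmle, hlt⟩ := exists_dyadic_bracket hMpos hLM
      set m : ℕ := M * 2 ^ j with hm
      have hmpos : 0 < m := by positivity
      haveI : NeZero m := ⟨hmpos.ne'⟩
      have hL0b : L0b ≤ m := hML0b.trans (by
        calc M = M * 2 ^ 0 := by ring
          _ ≤ M * 2 ^ j := Nat.mul_le_mul_left M (Nat.one_le_two_pow))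
      obtain ⟨β', hW', hmatch⟩ := hM lam hlam hhalf L m β hW
      have h1 := HB lam hlam hleB m L hL0b hmle hlt β β' hW hW' hmatch.symm
      have h2 := chain j m rfl β' hW'
      have hb' : 0 < topValue su2Rep m β' ^ m := pow_pos (topValue_su2Rep_pos m β') _
      have h3 := le_of_pair_of_partner hb' hb h1 h2
      refine h3.trans (exp_mul_le_exp_mul ?_ hb)
      rw [hmatch]
      set Λ : ℝ := luscherLambda β L with hΛ
      show Cb * Λ ^ 2 + (-(luscherEps1 * Λ) + Φ m * Λ ^ 2 + D * (Λ ^ 3 / 2 - 1 / β')) ≤ -(luscherEps1 * Λ - Ctot * Λ ^ 2)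
      have hβ'0 : 0 < β' := by linarith [hW'.1]
      have hDβ' : 0 ≤ D * (1 / β') := mul_nonneg hD (by positivity)
      have hsplit : D * (Λ ^ 3 / 2 - 1 / β') = D * (Λ ^ 3 / 2) - D * (1 / β') := by ring
      have hDc : D * (Λ ^ 3 / 2) ≤ D / 2 * Λ ^ 2 := by
        have := mul_le_mul_of_nonneg_left hcube hD
        linarith
      have hsum : (Cb + Φ m) * Λ ^ 2 ≤ (Cbp + K0 + Cop / κ) * Λ ^ 2 :=
        mul_le_mul_of_nonneg_right (by linarith [hΦle m]) (sq_nonneg Λ)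
      rw [hsplit]
      have hC : Ctot * Λ ^ 2 = (Cbp + K0 + Cop / κ) * Λ ^ 2 + D / 2 * Λ ^ 2 := by rw [hCtot]; ring
      have hsum' : Cb * Λ ^ 2 + Φ m * Λ ^ 2 = (Cb + Φ m) * Λ ^ 2 := by ring
      linarith [hsum, hDc, hDβ', hC, hsum']
  exact root_of_pow_le (secondValue_su2Rep_pos (by linarith [hW.1])).le (topValue_su2Rep_pos L β).le hpow

end Summit.QuantumFields.YangMills.Theorems.FemtoTransferGap.CutoffLadder

end
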